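import Literature.MathematicalPhysics.QuantumFieldTheory.Balaban1983to89.B5Eq112RenormTransf
import Literature.MathematicalPhysics.QuantumFieldTheory.Balaban1983to89.B5HierGaugeTorus
import Literature.MathematicalPhysics.QuantumFieldTheory.Balaban1983to89.B5HierAxialGaugeV1
import Literature.MathematicalPhysics.QuantumFieldTheory.Balaban1983to89.B5Composition116

/-!
# `Balaban1983to89.B5Eq112TorusCarriers` — T. Bałaban, *Propagators and renormalization transformations for lattice gauge
theories. I*, Commun. Math. Phys. **95** (1984) 17–40 [Balaban1984PropagatorsI], Sect. A pp. 18–20: ONE lattice, TWO formalizations —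
the carrier identification `T^{(j)} ≃ T_η` between the V1 lattice calculus (`LatticeFieldCalculus`, `Setup`) and the torus carrier of
the B5 files (`B5SectBStatements`), the dictionaries for (1.1)/(1.3)/(1.4)/(1.11)/(1.13), and the two block-axial gauges (1.10) as
complete gauge fixings of the residual group `{λ : Q′λ = 0}` (file 1 of the (1.12) knitting; file 2 = `B5Eq112TorusBridge`)

statement-level skeleton of published theorems with citation tags; proofs where landed; nothing here is a claim about the Yang–Mills mass gap

PDF held: `paper:balaban1984-cmp95-propagators-rt-i` (journal page = PDF page + 16); pp. 18–21 [PDF 2–5] read from the materialised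
text `~/.lit/texts/paper-balaban1984-cmp95-propagators-rt-i/p0002.txt … p0005.txt` (and the ×2 page renders under
`run/shared/lean/pub/pub-balaban/b2b-balaban-ref1/pages/1984-cmp95-propagators-rt-I/`).

PRINT, verbatim.  p. 19 [PDF 3]: *"so fixing the average, we restrict the gauge transformations by the condition λ(y) = 0, y ∈ T_L^{(1)},
for nonconstant λ. We still have the invariance with respect to the restricted transformations and we remove it by introducing Axial (Ax)
gauge fixing conditions A(Γ_{y,x}) = 0, x∈B(y), x ≠ y, y∈T_L^{(1)}. … (QA)_c = Σ_{x∈B(c₋)} L^{−(d+1)}A([x, x(c)]), … (1.11) … We may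
look at this expression also in a little bit different way. We may define the averaging operation as given by Q directly. Then the
average field B transforms as … = B_c − (∂Q′λ)(c). (1.13)  Fixing it we restrict the gauge transformations by the condition
(Q′λ)(y) = 0. The remaining gauge degrees of freedom are removed by the term δ_Ax(A). In the future we will use both points of view."*
p. 20 [PDF 4]: *"The δ-function δ(B − Q_kA) is invariant with respect to gauge transformations λ satisfying Q′_kλ = 0 and we can look
at the integral (1.17) as obtained by removing this gauge freedom by the help of the δ-functions δ_Ax."*

CITATION HEADER (lean-in-tree rule) — WHAT IS REPRODUCED.  SKELETON row `B5.Eq1.12` ([DEF]; fold owner r02; decl of record = seat p16's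
`B5Eq112RenormTransf.renormTransf`, lead ruling G.5-34(c)) — the KNITTING item left open in `B5SectBStatements` ("TWIN CARRIER BY
DESIGN … a bridge between the two carriers is a later knitting item") and in HOME/HANDOFF.md (p16 gen 2), FILE 1 of 2.  The two
vocabularies: V1 (`LatticeFieldCalculus`, the cross-paper carrier of record): sites `Site P j = (Fin d → ZMod (2L^{m+K−j}))`, bond
fields `PBond P j → ℝ`, `bondAvg` (1.11), `siteAvg` (1.13), `grad` (1.4), `curlAction` (1.3), the axial gauge (1.10) `IsAxial` along
the staircases `Γ_{y,x}` issued from the block CENTRES `emb y` (B12's centred blocks, DIVERGENCE F3 of `pub-balaban`); torus twin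
(`B5SectBStatements`, B5 fold owner r02): `Fld N = EuclideanSpace ℝ (Tor N × Fin d)`, `Qlin` (1.11), `QsLin` (1.13),
`B5HierGaugeTorus.Dgrad` (1.4), `B5Action121.actionS` (1.3), the axial subspace `Ax` along the staircases (1.7) issued from the block
CORNERS `L·y`.
WHAT IS PROVED (kernel, no `sorry`, standard axioms; standing range `j + 1 ≤ m + K` of `Setup.Params`):
* §0 the CARRIER IDENTIFICATION `eSite : Site P j ≃ Tor (L·Mc)` (`B5Composition116.recast`; `Site P (j+1)` IS `Tor Mc`,
  `Mc = const (sitesPerDir (j+1))`): labels, unit steps (`eSite_shift`), blocks (`eSite_blockSite`) and straight contours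
  (`eSite_runSite_blockSite`) correspond; field transports `trV`/`trB`/`trS`/`trSc` (linear equivalences);
* §1 the DICTIONARIES (1.11) `Qlin_trV : Q(trV A) = trB (bondAvg A)`, (1.4) `trV_grad : trV (∂^cλ) = Dgrad c (trS λ)`, (1.13)
  `QsLin_trS : Q′(trS λ) = trSc (siteAvg λ)`, (1.3) `actionS_trV : S[cplx (trV A)] = curlAction w c A`;
* §2 BOTH axial gauges are COMPLETE gauge fixings of the residual group («The remaining gauge degrees of freedom are removed by the
  term δ_Ax(A)»): `isCompl_axialV1_orbitV1` (V1, centred trees: `VecField = {axial} ⊕ {∂λ : Q′λ = 0}`, from p37's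
  `B5HierAxialGaugeV1` and BIJ85's gauge function `BIJ85GaugeFunction5113.fluct`), `isCompl_Ax_Otor` (torus, corner trees: one level
  of p37's `B5HierGaugeTorus`); under the transport the two residual orbits COINCIDE (`map_trV_orbitV1`), so the transported
  centred-axial subspace `axT` is a second slice of the SAME orbit (`isCompl_axT_Otor`); «δ(B − QA) is invariant with respect to
  gauge transformations λ satisfying Q′λ = 0» = `Otor_le_ker`.
HONEST SCOPE.  The two axial subspaces `axT ≠ Ax` in general (different block trees); nothing here asserts they agree.  U = 1, real
(abelian) fields — the paper's own setting of Sect. 1 — every `d ≥ 1`, odd `L > 1` (the `Setup` parameters).  No new definition of a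
printed object: only transports/reindexings and the residual-orbit subspaces `{∂λ : Q′λ = 0}` as named abbreviations; no
`def … : Prop`, nothing is a named unproved fact.

Unit `lit-balaban-p16` gen 3 (Phase-2 proof seat p16; literature-prover-lit-balaban-p16-g3-0), HOME `run/shared/lean/pub/lit-balaban/`
(STATUS: `lit-balaban-p16/STATUS.md`), 2026-08-21.
-/

open scoped BigOperators Matrix

namespace Literature.MathematicalPhysics.QuantumFieldTheory.Balaban1983to89

namespace B5Eq112TorusCarriers

open LatticeFieldCalculus B5SectBStatements
open B5Prop11Plancherel (Tor fine unitVec)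
open B5Block118 (bpt tstep)
open B5Composition116 (recast recast_apply recast_add recast_natCast recast_tstep)
open B5Eq112RenormTransf
open Literature.MathematicalPhysics.QuantumFieldTheory.BalabanImbrieJaffe1984to88.BIJ85AxialPropagator411
  (isAxial_add isAxial_smul isAxial_zero)
open Literature.MathematicalPhysics.QuantumFieldTheory.BalabanImbrieJaffe1984to88.BIJ85GaugeFunction5113
  (grad_add grad_smul siteAvg_add siteAvg_smul exists_blockSite_eq contour fluct siteAvg_fluct)

noncomputable section

variable {P : Params} {j : ℕ}

/-! ## §0  The carriers: `T^{(j)}` of `Setup` IS the torus `Tor (L·Mc)` of the B5 files, and `T^{(j+1)}` IS `Tor Mc` -/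

/-- The periods of the coarse torus `T_L^{(1)}` (= `T^{(j+1)}` of `Setup`): `sitesPerDir (j+1)` sites in every direction, so that
`Site P (j+1)` is LITERALLY `Tor (Mc P j)` and the fine torus `T^{(j)}` has the periods `fine L (Mc P j) = L·Mc` of the B5 files
(«we divide T₁ into blocks B(y) parametrized by the points of T_L^{(1)}», (1.6)). [cite: Balaban1984PropagatorsI, (1.6) p.18] -/
abbrev Mc (P : Params) (j : ℕ) : Fin P.d → ℕ := fun _ => P.sitesPerDir (j + 1)

/-- `L ≠ 0` as an instance (the B5 files take the block size as `[NeZero n]`). [cite: Balaban1984PropagatorsI, (1.6) p.18] -/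
instance instNeZeroL (P : Params) : NeZero P.L := ⟨P.L_pos.ne'⟩

/-- in the standing range `T^{(j)}` has `L·sitesPerDir (j+1)` sites per direction: the periods of `Site P j` are those of
`Tor (fine L Mc)`. [cite: Balaban1984PropagatorsI, (1.6) p.18] -/
theorem sitesPerDir_eq_fine (hj : j + 1 ≤ P.m + P.K) (ν : Fin P.d) :
    (fun _ : Fin P.d => P.sitesPerDir j) ν = fine P.L (Mc P j) ν := by
  show P.sitesPerDir j = P.L * P.sitesPerDir (j + 1)
  rw [P.sitesPerDir_eq_mul_succ hj, mul_comm]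

/-- **THE CARRIER IDENTIFICATION** `T^{(j)} ≃ T_η` of the two formalizations: the componentwise `ZMod.ringEquivCongr` along
`sitesPerDir j = L·sitesPerDir (j+1)` (`B5Composition116.recast`) — it preserves labels, addition and the unit steps, hence blocks,
straight contours and staircases. [cite: Balaban1984PropagatorsI, (1.6) p.18] -/
def eSite (hj : j + 1 ≤ P.m + P.K) : Site P j ≃ Tor (fine P.L (Mc P j)) :=
  recast (N := fun _ : Fin P.d => P.sitesPerDir j) (sitesPerDir_eq_fine hj)

/-- `eSite` acts componentwise. [cite: Balaban1984PropagatorsI, (1.6) p.18] -/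
theorem eSite_apply (hj : j + 1 ≤ P.m + P.K) (x : Site P j) (ν : Fin P.d) :
    eSite hj x ν = ZMod.ringEquivCongr (sitesPerDir_eq_fine hj ν) (x ν) := rfl

/-- `eSite` fixes natural-number label vectors. [cite: Balaban1984PropagatorsI, (1.6) p.18] -/
theorem eSite_natCast (hj : j + 1 ≤ P.m + P.K) (c : Fin P.d → ℕ) :
    eSite hj (fun ν => ((c ν : ℕ) : ZMod (P.sitesPerDir j))) = fun ν => ((c ν : ℕ) : ZMod (fine P.L (Mc P j) ν)) :=
  recast_natCast (N := fun _ : Fin P.d => P.sitesPerDir j) (sitesPerDir_eq_fine hj) c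

/-- `eSite (x + e_μ) = eSite x + e_μ`: nearest neighbours go to nearest neighbours (the bonds `⟨x, x + εe_μ⟩` of (1.1)).
[cite: Balaban1984PropagatorsI, (1.1) p.18] -/
theorem eSite_shift (hj : j + 1 ≤ P.m + P.K) (x : Site P j) (μ : Fin P.d) :
    eSite hj (x.shift μ) = eSite hj x + unitVec (fine P.L (Mc P j)) μ := by
  funext ν
  simp only [eSite_apply, Pi.add_apply, unitVec, Site.shift]
  by_cases hν : ν = μ
  · subst hν
    rw [Function.update_self, Pi.single_eq_same, map_add, map_one]
  · rw [Function.update_of_ne hν, Pi.single_eq_of_ne hν, add_zero]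

/-- the straight contours `[x, x(c)]` of (1.11) in the two coordinate systems: the `t`-th site from the block point of offset `r` in
`B(y)` is `eSite (blockSite y r + t e_μ) = L·y + r + t e_μ = bpt y r + tstep μ t`. [cite: Balaban1984PropagatorsI, (1.11) p.19] -/
theorem eSite_runSite_blockSite (hj : j + 1 ≤ P.m + P.K) (y : Site P (j + 1)) (r : Fin P.d → Fin P.L) (μ : Fin P.d)
    (t : ℕ) : eSite hj (runSite (Site.blockSite y r) μ t) = bpt P.L (Mc P j) y r + tstep (fine P.L (Mc P j)) μ t := by
  have h1 : runSite (Site.blockSite y r) μ t =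
      fun ν => (((y ν).val * P.L + r ν + if ν = μ then t else 0 : ℕ) : ZMod (P.sitesPerDir j)) := by
    funext ν
    by_cases hν : ν = μ
    · subst hν
      simp only [runSite, Function.update_self, Site.blockSite, if_true]
      push_cast
      ring
    · simp only [runSite, Function.update_of_ne hν, Site.blockSite, if_neg hν, add_zero]
  have h2 : bpt P.L (Mc P j) y r + tstep (fine P.L (Mc P j)) μ t =
      fun ν => (((y ν).val * P.L + r ν + if ν = μ then t else 0 : ℕ) : ZMod (fine P.L (Mc P j) ν)) := by
    funext ν
    rw [Pi.add_apply, B5Blocks16.bpt_eq_natCast]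
    by_cases hν : ν = μ
    · subst hν
      simp only [tstep, if_true]
      push_cast
      ring
    · simp only [tstep, if_neg hν, add_zero]
      push_cast
      ring
  rw [h1, eSite_natCast, h2]

/-- the blocks correspond: `eSite (blockSite y r) = bpt y r` («x ∈ B(y)», `x = Ly + r`). [cite: Balaban1984PropagatorsI, (1.6) p.18] -/
theorem eSite_blockSite (hj : j + 1 ≤ P.m + P.K) (y : Site P (j + 1)) (r : Fin P.d → Fin P.L) :
    eSite hj (Site.blockSite y r) = bpt P.L (Mc P j) y r := by
  have h := eSite_runSite_blockSite hj y r ⟨0, P.hd⟩ 0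
  rwa [runSite_zero, B5Block118.tstep_zero, add_zero] at h

/-- positively oriented bonds `⟨x, x + εe_μ⟩ ↔ (x, μ)` reindexed along `eSite`. [cite: Balaban1984PropagatorsI, (1.1) p.18] -/
def eBond (hj : j + 1 ≤ P.m + P.K) : PBond P j ≃ Tor (fine P.L (Mc P j)) × Fin P.d :=
  bondEquiv.symm.trans ((eSite hj).prodCongr (Equiv.refl _))

/-- `eBond ⟨x, μ⟩ = (eSite x, μ)`. [cite: Balaban1984PropagatorsI, (1.1) p.18] -/
theorem eBond_apply (hj : j + 1 ≤ P.m + P.K) (b : PBond P j) : eBond hj b = (eSite hj b.src, b.dir) := rfl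

/-- `eBond⁻¹ (x, μ) = ⟨eSite⁻¹ x, μ⟩`. [cite: Balaban1984PropagatorsI, (1.1) p.18] -/
theorem eBond_symm_apply (hj : j + 1 ≤ P.m + P.K) (x : Tor (fine P.L (Mc P j))) (μ : Fin P.d) :
    (eBond hj).symm (x, μ) = ⟨(eSite hj).symm x, μ⟩ := rfl

/-- **transport of fine vector fields** `A_μ(x)` (1.1): a V1 bond field read as a real field on the torus carrier (a linear
equivalence; on Euclidean coordinates it is the isometric reindexing along `eBond`). [cite: Balaban1984PropagatorsI, (1.1) p.18] -/
def trV (hj : j + 1 ≤ P.m + P.K) : VecField P j ℝ ≃ₗ[ℝ] Fld (fine P.L (Mc P j)) :=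
  (LinearEquiv.funCongrLeft ℝ ℝ (eBond hj).symm).trans (WithLp.linearEquiv 2 ℝ (Tor (fine P.L (Mc P j)) × Fin P.d → ℝ)).symm

/-- values of the transported field. [cite: Balaban1984PropagatorsI, (1.1) p.18] -/
theorem trV_apply (hj : j + 1 ≤ P.m + P.K) (A : VecField P j ℝ) (i : Tor (fine P.L (Mc P j)) × Fin P.d) :
    trV hj A i = A ((eBond hj).symm i) := rfl

/-- values of the pulled-back field. [cite: Balaban1984PropagatorsI, (1.1) p.18] -/
theorem trV_symm_apply (hj : j + 1 ≤ P.m + P.K) (A' : Fld (fine P.L (Mc P j))) (b : PBond P j) :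
    (trV hj).symm A' b = A' (eBond hj b) := rfl

/-- **transport of coarse (block) fields** `B_c`, `c = ⟨y, y + e_μ⟩ ⊂ T_L^{(1)}`: the same function, `Site P (j+1)` being `Tor Mc`.
[cite: Balaban1984PropagatorsI, (1.8) p.19] -/
def trB : VecField P (j + 1) ℝ ≃ₗ[ℝ] Fld (Mc P j) :=
  (LinearEquiv.funCongrLeft ℝ ℝ (bondEquiv (P := P) (j := j + 1))).trans
    (WithLp.linearEquiv 2 ℝ (Tor (Mc P j) × Fin P.d → ℝ)).symm

/-- values of the transported block field. [cite: Balaban1984PropagatorsI, (1.8) p.19] -/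
theorem trB_apply (B : VecField P (j + 1) ℝ) (i : Tor (Mc P j) × Fin P.d) : trB B i = B ⟨i.1, i.2⟩ := rfl

/-- **transport of fine gauge functions** `λ(x)` (1.4) along `eSite`. [cite: Balaban1984PropagatorsI, (1.4) p.18] -/
def trS (hj : j + 1 ≤ P.m + P.K) : SiteField P j ℝ ≃ₗ[ℝ] Scl (fine P.L (Mc P j)) :=
  (LinearEquiv.funCongrLeft ℝ ℝ (eSite hj).symm).trans (WithLp.linearEquiv 2 ℝ (Tor (fine P.L (Mc P j)) → ℝ)).symm

/-- values of the transported gauge function. [cite: Balaban1984PropagatorsI, (1.4) p.18] -/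
theorem trS_apply (hj : j + 1 ≤ P.m + P.K) (lam : SiteField P j ℝ) (x : Tor (fine P.L (Mc P j))) :
    trS hj lam x = lam ((eSite hj).symm x) := rfl

/-- transport of coarse gauge functions `λ₁` on `T_L^{(1)}` ((1.13): `Q′λ`): the same function. [cite: Balaban1984PropagatorsI, (1.13) p.19] -/
def trSc : SiteField P (j + 1) ℝ ≃ₗ[ℝ] Scl (Mc P j) :=
  (WithLp.linearEquiv 2 ℝ (Tor (Mc P j) → ℝ)).symm

/-- values. [cite: Balaban1984PropagatorsI, (1.13) p.19] -/
theorem trSc_apply (mu : SiteField P (j + 1) ℝ) (y : Tor (Mc P j)) : trSc mu y = mu y := rfl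

/-! ## §1  Dictionaries: the printed operators (1.11), (1.4), (1.13), (1.3) agree across the carrier identification -/

/-- **(1.11) `(QA)_c = Σ_{x∈B(c₋)} L^{−(d+1)}A([x, x(c)])` is ONE operator**: the B5 files' `Qlin` of the transported field is the
transported V1 average `bondAvg` (same blocks, same straight contours). [cite: Balaban1984PropagatorsI, (1.11) p.19] -/
theorem Qlin_trV (hj : j + 1 ≤ P.m + P.K) (A : VecField P j ℝ) :
    Qlin P.L (Mc P j) (trV hj A) = trB (bondAvg A) := by
  ext ⟨y, μ⟩
  rw [Qlin_apply, trB_apply]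
  simp only [qFun, trV_apply, eBond_symm_apply, bondAvg, segSum, runBond, smul_eq_mul]
  have hpt : ∀ (r : Fin P.d → Fin P.L) (t : ℕ),
      (eSite hj).symm (bpt P.L (Mc P j) y r + tstep (fine P.L (Mc P j)) μ t) = runSite (Site.blockSite y r) μ t := by
    intro r t
    rw [Equiv.symm_apply_eq, eSite_runSite_blockSite]
  simp only [hpt]
  congr 1
  · rw [one_div]
  · refine Finset.sum_congr rfl fun r _ => ?_
    exact Fin.sum_univ_eq_sum_range (fun t => A ⟨runSite (Site.blockSite y r) μ t, μ⟩) P.L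

/-- **(1.4) `A^λ = A − ∂λ` is ONE operation**: the transported V1 gradient `grad c λ` is the B5 files' `Dgrad c` of the transported
gauge function. [cite: Balaban1984PropagatorsI, (1.4) p.18] -/
theorem trV_grad (hj : j + 1 ≤ P.m + P.K) (c : ℝ) (lam : SiteField P j ℝ) :
    trV hj (grad c lam) = B5HierGaugeTorus.Dgrad (fine P.L (Mc P j)) c (trS hj lam) := by
  ext ⟨x, μ⟩
  rw [trV_apply, B5HierGaugeTorus.Dgrad_apply, eBond_symm_apply, trS_apply, trS_apply]
  have h : (eSite hj).symm (x + unitVec (fine P.L (Mc P j)) μ) = ((eSite hj).symm x).shift μ := by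
    rw [Equiv.symm_apply_eq, eSite_shift, Equiv.apply_symm_apply]
  simp only [grad, PBond.tgt, h, smul_eq_mul]

/-- **(1.13) `(Q′λ)(y) = Σ_{x∈B(y)} L^{−d}λ(x)` is ONE operator**: `QsLin` of the transported gauge function is the transported V1
`siteAvg`. [cite: Balaban1984PropagatorsI, (1.13) p.19] -/
theorem QsLin_trS (hj : j + 1 ≤ P.m + P.K) (lam : SiteField P j ℝ) :
    QsLin P.L (Mc P j) (trS hj lam) = trSc (siteAvg lam) := by
  ext y
  rw [QsLin_apply, trSc_apply]
  simp only [qsFun, trS_apply, siteAvg, smul_eq_mul]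
  have hpt : ∀ r : Fin P.d → Fin P.L, (eSite hj).symm (bpt P.L (Mc P j) y r) = Site.blockSite y r := by
    intro r
    rw [Equiv.symm_apply_eq, eSite_blockSite]
  simp only [hpt, one_div]

/-- **(1.3) `S(A) = ½Σ_p ε^d|F(p)|²` is ONE functional**: the B5 files' `actionS` (lattice factor `c`, weight `w`) of the transported,
complexified field is V1's `curlAction w c` (same plaquettes `p = ⟨x, x+e_μ, x+e_μ+e_ν, x+e_ν⟩`, `μ < ν`). [cite: Balaban1984PropagatorsI, (1.3) p.18] -/
theorem actionS_trV (hj : j + 1 ≤ P.m + P.K) (c w : ℝ) (A : VecField P j ℝ) :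
    B5Action121.actionS (fine P.L (Mc P j)) (c : ℂ) w (cplx (trV hj A)) = curlAction w c A := by
  -- the plaquette field on the transported configuration
  have hF : ∀ (x : Site P j) (μ ν : Fin P.d) (h : μ < ν),
      B5Action121.Fs (fine P.L (Mc P j)) (c : ℂ) (cplx (trV hj A)) μ ν (eSite hj x)
        = ((curl c A ⟨x, μ, ν, h⟩ : ℝ) : ℂ) := by
    intro x μ ν h
    rw [B5Action121.Fs_apply]
    simp only [cplx, trV_apply, eBond_symm_apply, ← eSite_shift, Equiv.symm_apply_apply, curl, smul_eq_mul]
    push_cast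
    ring
  unfold B5Action121.actionS curlAction
  congr 1
  -- reindex the plaquette sum
  have hP : ∑ p : Plaq P j, w * ‖curl c A p‖ ^ 2
      = ∑ x : Site P j, ∑ μ : Fin P.d, ∑ ν : Fin P.d, if h : μ < ν then w * ‖curl c A ⟨x, μ, ν, h⟩‖ ^ 2 else 0 := by
    set F : Site P j × Fin P.d × Fin P.d → ℝ :=
      fun a => if h : a.2.1 < a.2.2 then w * ‖curl c A ⟨a.1, a.2.1, a.2.2, h⟩‖ ^ 2 else 0 with hFdef
    let e : {t : Site P j × Fin P.d × Fin P.d // t.2.1 < t.2.2} ≃ Plaq P j :=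
      ⟨fun t => ⟨t.1.1, t.1.2.1, t.1.2.2, t.2⟩, fun p => ⟨(p.src, p.μ, p.ν), p.hμν⟩, fun _ => rfl, fun _ => rfl⟩
    have h1 : ∑ p : Plaq P j, w * ‖curl c A p‖ ^ 2 = ∑ t : {t : Site P j × Fin P.d × Fin P.d // t.2.1 < t.2.2}, F t.1 := by
      rw [← Equiv.sum_comp e]
      refine Fintype.sum_congr _ _ fun t => ?_
      simp only [hFdef, dif_pos t.2]
      rfl
    have h2 : ∑ t : {t : Site P j × Fin P.d × Fin P.d // t.2.1 < t.2.2}, F t.1 = ∑ a, F a := by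
      rw [← Finset.sum_subtype (Finset.univ.filter fun t : Site P j × Fin P.d × Fin P.d => t.2.1 < t.2.2)
        (fun t => by simp) F, Finset.sum_filter]
      refine Finset.sum_congr rfl fun a _ => ?_
      by_cases h : a.2.1 < a.2.2
      · rw [if_pos h]
      · rw [if_neg h, hFdef]
        simp only [dif_neg h]
    rw [h1, h2, Fintype.sum_prod_type]
    exact Finset.sum_congr rfl fun x _ => Fintype.sum_prod_type _
  rw [hP, ← Equiv.sum_comp (eSite hj)]
  refine Finset.sum_congr rfl fun x _ => Finset.sum_congr rfl fun μ _ => Finset.sum_congr rfl fun ν _ => ?_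
  by_cases h : μ < ν
  · rw [if_pos h, dif_pos h, hF x μ ν h, Complex.norm_real]
  · rw [if_neg h, dif_neg h]


/-! ## §2  Both axial gauges are slices of the residual gauge orbit `{∂λ : Q′λ = 0}`

«Fixing it we restrict the gauge transformations by the condition (Q′λ)(y) = 0. The remaining gauge degrees of freedom are removed by
the term δ_Ax(A).» (p. 19): the field space is the direct sum of the axial subspace and the orbit directions `{∂λ : Q′λ = 0}` — for
EITHER choice of the block trees. -/

section V1Slice

/-- the CENTRED block-axial subspace of V1 (`IsAxial`: `A(Γ_{y,x}) = 0`, staircases from the block centres), as a submodule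
(linearity from `BIJ85AxialPropagator411`). [cite: Balaban1984PropagatorsI, (1.10) p.19] -/
def axialV1 (P : Params) (j : ℕ) : Submodule ℝ (VecField P j ℝ) where
  carrier := {A | IsAxial A}
  zero_mem' := isAxial_zero
  add_mem' hA hB := isAxial_add hA hB
  smul_mem' a _ hA := isAxial_smul a hA

/-- membership. [cite: Balaban1984PropagatorsI, (1.10) p.19] -/
theorem mem_axialV1_iff (A : VecField P j ℝ) : A ∈ axialV1 P j ↔ IsAxial A := Iff.rfl

/-- `∂` with lattice factor `c` as a linear map («A^λ = A − ∂λ» is linear in `λ`). [cite: Balaban1984PropagatorsI, (1.4) p.18] -/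
def gradL (c : ℝ) : SiteField P j ℝ →ₗ[ℝ] VecField P j ℝ where
  toFun := grad c
  map_add' := grad_add c
  map_smul' a f := grad_smul c a f

/-- `Q′` (1.13) as a linear map. [cite: Balaban1984PropagatorsI, (1.13) p.19] -/
def siteAvgL : SiteField P j ℝ →ₗ[ℝ] SiteField P (j + 1) ℝ where
  toFun := siteAvg
  map_add' := siteAvg_add
  map_smul' := siteAvg_smul

/-- the residual gauge orbit directions on V1, `{∂λ : Q′λ = 0}` («we restrict the gauge transformations by the condition
(Q′λ)(y) = 0»; lattice factor `1` — the subspace does not depend on a nonzero factor). [cite: Balaban1984PropagatorsI, (1.13) p.19] -/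
def orbitV1 (P : Params) (j : ℕ) : Submodule ℝ (VecField P j ℝ) :=
  (LinearMap.ker (siteAvgL (P := P) (j := j))).map (gradL 1)

/-- membership. [cite: Balaban1984PropagatorsI, (1.13) p.19] -/
theorem mem_orbitV1_iff (A : VecField P j ℝ) :
    A ∈ orbitV1 P j ↔ ∃ lam : SiteField P j ℝ, siteAvg lam = 0 ∧ grad 1 lam = A := by
  simp only [orbitV1, Submodule.mem_map, LinearMap.mem_ker]
  rfl

/-- a pure gauge `∂λ` in the centred axial gauge has `λ` constant on blocks («λ(x) = λ₁(y) for x ∈ B(y)»), by the staircase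
telescoping `(∂λ)(Γ_{y,x}) = λ(x) − λ(y)`. [cite: Balaban1984PropagatorsI, (1.15) p.19] -/
theorem blockConst_of_isAxial_grad (hj : j + 1 ≤ P.m + P.K) {lam : SiteField P j ℝ} (h : IsAxial (grad 1 lam)) :
    lam = blockConst (fun y => lam (emb y)) := by
  funext x
  obtain ⟨r, hr⟩ := exists_blockSite_eq hj x
  rw [← hr, blockConst_blockSite hj]
  by_cases hx : Site.blockSite (blockOf x) r = emb (blockOf x)
  · rw [hx]
  · have h1 := h (blockOf x) r hx
    rw [B5Eq120IterProof.stairSum_grad, one_smul, sub_eq_zero] at h1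
    exact h1

/-- **`VecField = {axial} ⊕ {∂λ : Q′λ = 0}` on V1 (centred trees)**: disjointness = the previous lemma + `Q′(block constant) =
that constant`; spanning = BIJ85's gauge function `fluct A` (contour functional minus its block mean, `Q′(fluct A) = 0`) puts `A` in
the axial gauge. [cite: Balaban1984PropagatorsI, (1.13) p.19] -/
theorem isCompl_axialV1_orbitV1 (hj : j + 1 ≤ P.m + P.K) : IsCompl (axialV1 P j) (orbitV1 P j) := by
  refine IsCompl.of_eq ?_ ?_
  · rw [Submodule.eq_bot_iff]
    intro A hA
    obtain ⟨hAx, hO⟩ := Submodule.mem_inf.1 hA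
    obtain ⟨lam, hlam, rfl⟩ := (mem_orbitV1_iff A).1 hO
    have hc := blockConst_of_isAxial_grad hj hAx
    have hμ : (fun y => lam (emb y)) = 0 := by
      have h2 := siteAvg_blockConst hj (fun y => lam (emb y))
      rw [← hc, hlam] at h2
      exact h2.symm
    rw [hc, hμ]
    funext b
    simp only [grad, blockConst, Pi.zero_apply, sub_self, smul_zero]
  · rw [Submodule.eq_top_iff']
    intro A
    refine Submodule.mem_sup.2 ⟨gaugeShift 1 (fluct A) A, ?_, grad 1 (fluct A),
      (mem_orbitV1_iff _).2 ⟨fluct A, siteAvg_fluct hj A, rfl⟩, ?_⟩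
    · show IsAxial (gaugeShift 1 (fluct A) A)
      rw [B5HierAxialGaugeV1.isAxial_gaugeShift_iff one_ne_zero]
      intro y r
      simp only [fluct, contour, Site.blockOf_blockSite hj, Site.blockOf_emb hj, stairSum_self, inv_one, one_smul]
      ring
    · funext b
      simp only [gaugeShift, Pi.add_apply, sub_add_cancel]

end V1Slice

section TorSlice

variable {d : ℕ} (n : ℕ) [NeZero n] (M : Fin d → ℕ) [hM : ∀ μ, NeZero (M μ)]

/-- the residual gauge orbit directions on the torus carrier (one level, lattice factor `1`): `{∂λ : Q′λ = 0}`.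
[cite: Balaban1984PropagatorsI, (1.13) p.19] -/
def Otor : Submodule ℝ (Fld (fine n M)) :=
  (LinearMap.ker (QsLin n M)).map (B5HierGaugeTorus.Dgrad (fine n M) 1)

omit [NeZero n] hM in
/-- membership. [cite: Balaban1984PropagatorsI, (1.13) p.19] -/
theorem mem_Otor_iff (g : Fld (fine n M)) :
    g ∈ Otor n M ↔ ∃ l : Scl (fine n M), QsLin n M l = 0 ∧ B5HierGaugeTorus.Dgrad (fine n M) 1 l = g := by
  simp only [Otor, Submodule.mem_map, LinearMap.mem_ker]

/-- «The δ-function δ(B − Q_kA) is invariant with respect to gauge transformations λ satisfying Q′_kλ = 0» (p. 20, by (1.20)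
`QA^λ = QA − ∂Q′λ`): `{∂λ : Q′λ = 0} ≤ N(Q)`. [cite: Balaban1984PropagatorsI, (1.20) p.20] -/
theorem Otor_le_ker : Otor n M ≤ LinearMap.ker (Qlin n M) := by
  intro g hg
  obtain ⟨l, hl, rfl⟩ := (mem_Otor_iff n M g).1 hg
  rw [LinearMap.mem_ker]
  have h := B5HierGaugeTorus.Qlin_Dgrad_mul n M (1 / n) l
  rwa [one_div, inv_mul_cancel₀ (Nat.cast_ne_zero.2 (NeZero.ne n)), hl, map_zero] at h

/-- **`Fld = {axial} ⊕ {∂λ : Q′λ = 0}` on the torus carrier (corner trees of (1.7))**: one level of p37's `B5HierGaugeTorus`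
(`exists_QsLin_eq_zero_add_Dgrad_mem_Ax` / `eq_zero_of_QsLin_eq_zero_of_Dgrad_mem_Ax`). [cite: Balaban1984PropagatorsI, (1.13) p.19] -/
theorem isCompl_Ax_Otor : IsCompl (Ax n M) (Otor n M) := by
  refine IsCompl.of_eq ?_ ?_
  · rw [Submodule.eq_bot_iff]
    intro A hA
    obtain ⟨hAx, hO⟩ := Submodule.mem_inf.1 hA
    obtain ⟨l, hl, rfl⟩ := (mem_Otor_iff n M A).1 hO
    rw [B5HierGaugeTorus.eq_zero_of_QsLin_eq_zero_of_Dgrad_mem_Ax n M one_ne_zero hl hAx, map_zero]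
  · rw [Submodule.eq_top_iff']
    intro A
    obtain ⟨l, hl, hAx⟩ := B5HierGaugeTorus.exists_QsLin_eq_zero_add_Dgrad_mem_Ax n M one_ne_zero A
    refine Submodule.mem_sup.2 ⟨A + B5HierGaugeTorus.Dgrad _ 1 l, hAx, B5HierGaugeTorus.Dgrad _ 1 (-l),
      (mem_Otor_iff n M _).2 ⟨-l, by rw [map_neg, hl, neg_zero], rfl⟩, ?_⟩
    rw [map_neg, add_neg_cancel_right]

end TorSlice

section Transported

/-- the CENTRED axial subspace of V1 carried to the torus carrier along `trV` — a second axial-type gauge on `Fld (L·Mc)`,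
different from `Ax` (other block trees). [cite: Balaban1984PropagatorsI, (1.10) p.19] -/
def axT (hj : j + 1 ≤ P.m + P.K) : Submodule ℝ (Fld (fine P.L (Mc P j))) :=
  (axialV1 P j).map ((trV hj : VecField P j ℝ ≃ₗ[ℝ] Fld (fine P.L (Mc P j))) : VecField P j ℝ →ₗ[ℝ] _)

/-- membership: `A′ ∈ axT ↔ trV⁻¹A′` is centred-axial. [cite: Balaban1984PropagatorsI, (1.10) p.19] -/
theorem mem_axT_iff (hj : j + 1 ≤ P.m + P.K) (A' : Fld (fine P.L (Mc P j))) :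
    A' ∈ axT hj ↔ IsAxial ((trV hj).symm A') :=
  Submodule.mem_map_equiv (axialV1 P j) (e := trV hj)

/-- (1.4) pulled back: `trV⁻¹(∂^cλ) = ∂^c(trS⁻¹λ)`. [cite: Balaban1984PropagatorsI, (1.4) p.18] -/
theorem trV_symm_Dgrad (hj : j + 1 ≤ P.m + P.K) (c : ℝ) (l : Scl (fine P.L (Mc P j))) :
    (trV hj).symm (B5HierGaugeTorus.Dgrad _ c l) = grad c ((trS hj).symm l) := by
  apply (trV hj).injective
  rw [trV_grad, LinearEquiv.apply_symm_apply, LinearEquiv.apply_symm_apply]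

/-- **the two residual orbits coincide**: `trV` maps `{∂λ : Q′λ = 0}` of V1 onto `{∂λ : Q′λ = 0}` of the torus carrier
(dictionaries (1.4), (1.13)). [cite: Balaban1984PropagatorsI, (1.13) p.19] -/
theorem map_trV_orbitV1 (hj : j + 1 ≤ P.m + P.K) :
    (orbitV1 P j).map ((trV hj : VecField P j ℝ ≃ₗ[ℝ] Fld (fine P.L (Mc P j))) : VecField P j ℝ →ₗ[ℝ] _)
      = Otor P.L (Mc P j) := by
  ext A'
  rw [Submodule.mem_map_equiv, mem_orbitV1_iff, mem_Otor_iff]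
  constructor
  · rintro ⟨lam, hlam, hA⟩
    refine ⟨trS hj lam, by rw [QsLin_trS, hlam, map_zero], ?_⟩
    rw [← trV_grad, hA, LinearEquiv.apply_symm_apply]
  · rintro ⟨l, hl, hA⟩
    refine ⟨(trS hj).symm l, ?_, by rw [← trV_symm_Dgrad, hA]⟩
    have h := QsLin_trS hj ((trS hj).symm l)
    rw [LinearEquiv.apply_symm_apply, hl] at h
    exact (LinearEquiv.map_eq_zero_iff _).1 h.symm

/-- **the transported centred-axial subspace is a second slice of the torus-side residual orbit**: `Fld = axT ⊕ {∂λ : Q′λ = 0}`.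
[cite: Balaban1984PropagatorsI, (1.13) p.19] -/
theorem isCompl_axT_Otor (hj : j + 1 ≤ P.m + P.K) : IsCompl (axT hj) (Otor P.L (Mc P j)) := by
  have h := (Submodule.orderIsoMapComap (trV hj)).isCompl (isCompl_axialV1_orbitV1 hj)
  rw [← map_trV_orbitV1 hj]
  exact h

end Transported

end

end B5Eq112TorusCarriers

end Literature.MathematicalPhysics.QuantumFieldTheory.Balaban1983to89
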